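import Literature.Geometry.Riemannian.KarpukhinSternBochner
import Literature.Geometry.Riemannian.MetricCutoff
import HarnessLib

/-!
# Karpukhin–Stern §3.2: Prop. 3.5 on geodesic balls and Lemma 3.7 (uniform `L⁶` bounds) from Lemma 3.6
(third proof file of `KarpukhinSternHarmonicMaps.lean`; topic `Geometry/Riemannian`)

Continuation of `KarpukhinSternBochner.lean` toward
`Literature.Geometry.Riemannian.karpukhinStern_groundStateHarmonicMap` (Karpukhin–Stern,
Invent. Math. 236 (2024), Cor. 1.3 with Thm. 1.5), kept in a separate file because it needs the
geodesic-ball cut-offs of `MetricCutoff.lean` (`exists_metric_cutoff`: smooth `χ : N → [0,1]`,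
`χ = 1` on `B(p, s/2)`, `tsupport χ ⊆ B(p, s)`, `|dχ|² ≤ C₀/s²`, balls of the Riemannian distance
`PseudoRiemannianMetric.ball`). Everything is PROVED; no definitions, no named facts.

* `karpukhinStern_prop35_ball` — **Prop. 3.5 on geodesic balls** (p. 749): for every centre `p`
  and radius `s > 0` a constant `C = C(N, h, p, s, K)`, independent of `k` and of the map, with
  `∫_{B(p,s/4)} |du|⁶ ≤ C ∫_{B(p,s)} |du|²` for every smooth harmonic `u : N → Sᵏ`
  (`2 ≤ dim N ≤ 5`, `Ric ≥ −K h`) with `ind_E(u; B(p, s)) ≤ k − 202` — the analytic core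
  `karpukhinStern_prop35_core` fed with the cut-offs of `exists_metric_cutoff`, whose
  `|tr Hess(χ²)|` is bounded by compactness (`exists_abs_le_of_continuous`).
* `karpukhinStern_lemma37_of_lemma36` — **Lemma 3.7 from Lemma 3.6** (pp. 751–752): if some
  `δ > 0` has `ind_E(u; N ∖ B_δ(p)) ≥ k − 2` for all nonconstant smooth harmonic `u : N → Sᵏ` and
  all `p` (the conclusion of Lemma 3.6, hypothesis `h36`), then there is `C = C(N, h)` with
  `∫|du|⁶ ≤ C`, `∫|du|⁴ ≤ C`, `∫|d|du|²|² ≤ C` for every nonconstant smooth harmonic `u : N → Sᵏ`,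
  `k ≥ 205`, `ind_E(u) ≤ k + 1` — (3.8)–(3.9): `ind_E(u; B_δ(p)) ≤ 3` by additivity of the index
  over disjoint domains (`energyIndexOn_le_three`), Prop. 3.5 on finitely many balls `B(pᵢ, δ)`
  covering `N` by the `B(pᵢ, δ/4)`, Hölder and division, and (3.9) by
  `integral_gradSq_energyDensity_le`.

What remains of §3 for Prop. 3.8: Lemma 3.6 itself (energy monotonicity for harmonic maps and the
universal energy gap Prop. 5.5 of the appendix) and the compactness argument of Prop. 3.8
(Rellich–Kondrachov and the continuity of weighted eigenvalues [14]).

## References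

* M. Karpukhin, D. Stern, *Existence of harmonic maps and eigenvalue optimization in higher
  dimensions*, Invent. Math. 236 (2024) 713–778, §3.1 Prop. 3.5 (pp. 749–750), §3.2 Lemma 3.6,
  Lemma 3.7 (pp. 750–752). [KarpukhinStern2024]
* P. Topping, *Lectures on the Ricci flow*, LMS LN 325 (2006), §8.3 (metric cut-offs, as
  formalised in `MetricCutoff.lean`). [Topping2006]
-/

noncomputable section

open Module Finset
open scoped InnerProductSpace BigOperators Manifold ContDiff Topology

namespace Literature.Geometry.Riemannian

namespace KarpukhinStern

/-! ### Part H — Prop. 3.5 on geodesic balls; Lemma 3.7 from Lemma 3.6 -/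

section Balls

open Lorentzian Lorentzian.PseudoRiemannianMetric Bundle Filter Topology
open _root_.MeasureTheory
open scoped ENNReal NNReal

variable {m : ℕ} {H' : Type*} [TopologicalSpace H']
  {J : ModelWithCorners ℝ (EuclideanSpace ℝ (Fin m)) H'} [J.Boundaryless]
  {N : Type*} [TopologicalSpace N] [ChartedSpace H' N] [IsManifold J ∞ N] [CompactSpace N]
  [T2Space N] [T3Space N] [SecondCountableTopology N] [MeasurableSpace N] [BorelSpace N]
  (h : ContMDiffRiemannianMetric J ∞ (EuclideanSpace ℝ (Fin m)) (TangentSpace J : N → Type _))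
  [(ofRiemannian h).HasLeviCivita]

omit [T2Space N] [T3Space N] [SecondCountableTopology N] [MeasurableSpace N] [BorelSpace N] in
/-- A continuous function on the closed manifold is bounded. [folklore] -/
theorem exists_abs_le_of_continuous {f : N → ℝ} (hf : Continuous f) : ∃ B : ℝ, ∀ x, |f x| ≤ B := by
  obtain ⟨B, hB⟩ := isCompact_univ.exists_bound_of_continuousOn (f := f) hf.continuousOn
  exact ⟨B, fun x ↦ by simpa [Real.norm_eq_abs] using hB x (Set.mem_univ x)⟩

/-- **Karpukhin–Stern, Proposition 3.5 on geodesic balls** (p. 749: "`‖du‖⁶_{L⁶(B_{r/2}(p))} ⩽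
C(M) r⁻⁴ ‖du‖²_{L²(B_{2r}(p))}`" under `ind_E(u; B_{2r}(p)) ⩽ k − 2 − 200`, `k > 202`, `n ⩽ 5`):
for every centre `p` and radius `s > 0` there is a constant `C = C(N, h, p, s, K)`, independent of
`k` and of the map, such that every smooth harmonic `u : N → Sᵏ` (`2 ≤ dim N ≤ 5`, `Ric ≥ −K h`)
with `ind_E(u; B(p, s)) ≤ k − 202` satisfies `∫_{B(p, s/4)} |du|⁶ ≤ C ∫_{B(p, s)} |du|²`.
The cut-offs are those of `exists_metric_cutoff` (`MetricCutoff.lean`: `χ = 1` on `B(p, s/2)`,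
`tsupport χ ⊆ B(p, s)`, `|dχ|² ≤ C₀/s²`), their `|tr Hess(χ²)|` being bounded by compactness; the
analysis is `karpukhinStern_prop35_core`. (The printed dependence `C(M) r⁻⁴` is not asserted; for
the stabilisation argument, Lemma 3.7, only finitely many balls of a fixed radius are used.)
[cite: KarpukhinStern2024, Prop. 3.5 pp. 749–750] -/
theorem karpukhinStern_prop35_ball (hm2 : 2 ≤ m) (hm5 : m ≤ 5) {K : ℝ}
    (hK : ∀ (x : N) (v : TangentSpace J x),
      -(K * (ofRiemannian h).val x v v) ≤ (ofRiemannian h).ricci x v v) (hK0 : 0 ≤ K)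
    (p : N) {s : ℝ} (hs : 0 < s) :
    ∃ C : ℝ, 0 ≤ C ∧ ∀ {k : ℕ} (u : N → Metric.sphere (0 : EuclideanSpace ℝ (Fin (k + 1))) 1)
      (hu : ContMDiff J (𝓡 k) ∞ u)
      (_harm : ∀ (i : Fin (k + 1)) (x : N), (ofRiemannian h).dalembertian
        (fun y ↦ (u y : EuclideanSpace ℝ (Fin (k + 1))) i) x =
          -(energyDensity h u x) * (u x : EuclideanSpace ℝ (Fin (k + 1))) i)
      (_hk : 202 ≤ k)
      (_hind : energyIndexOn h hu ((ofRiemannian h).ball p (ENNReal.ofReal s)) ≤ (k - 202 : ℕ)),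
      ∫ x in (ofRiemannian h).ball p (ENNReal.ofReal (s / 4)), energyDensity h u x ^ 3
          ∂riemannianMeasure h ≤
        C * ∫ x in (ofRiemannian h).ball p (ENNReal.ofReal s), energyDensity h u x
          ∂riemannianMeasure h := by
  set g := ofRiemannian h with hg
  have hgR : g.IsRiemannian := isRiemannian_ofRiemannian h
  obtain ⟨C₀, hC₀⟩ := exists_metric_cutoff.{_, _, _}
  obtain ⟨χ₁, hχ₁s, hχ₁0, hχ₁1, hχ₁one, hχ₁supp, hχ₁grad⟩ := hC₀ J N g hgR p s hs
  obtain ⟨χ₂, hχ₂s, hχ₂0, hχ₂1, hχ₂one, hχ₂supp, hχ₂grad⟩ := hC₀ J N g hgR p (s / 2) (half_pos hs)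
  obtain ⟨b₁, hb₁⟩ := exists_abs_le_of_continuous (f := g.dalembertian fun y ↦ χ₁ y ^ 2)
    (contMDiff_dalembertian g (hχ₁s.pow 2)).continuous
  obtain ⟨b₂, hb₂⟩ := exists_abs_le_of_continuous (f := g.dalembertian fun y ↦ χ₂ y ^ 2)
    (contMDiff_dalembertian g (hχ₂s.pow 2)).continuous
  set a₁ : ℝ := C₀ / s ^ 2 with ha₁
  set a₂ : ℝ := C₀ / (s / 2) ^ 2 with ha₂
  obtain ⟨hD₂, hD₄⟩ := prop35_constants_pos (m := m) hm2 hm5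
  have hm' : (2 : ℝ) ≤ m := by exact_mod_cast hm2
  set C : ℝ := (203 * (a₂ + (m : ℝ) / (2 * (3 * m - 2)) * b₂ + 4 * ((m : ℝ) - 1) / (3 * m - 2) * K) /
      (200 - 203 * (4 * ((m : ℝ) - 1) ^ 2 / ((m : ℝ) * (3 * m - 2))))) *
    ((203 * (a₁ + b₁ / (2 * m) + ((m : ℝ) - 1) / m * K) /
      (200 - 203 * (((m : ℝ) - 1) / m) ^ 2))) with hC
  -- nonnegativity of `C` (if `N` is empty every integral vanishes anyway)
  rcases isEmpty_or_nonempty N with hN | hN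
  · refine ⟨0, le_rfl, fun u hu _ _ _ ↦ ?_⟩
    have h1 : g.ball p (ENNReal.ofReal (s / 4)) = ∅ := Set.eq_empty_of_isEmpty _
    have h2 : g.ball p (ENNReal.ofReal s) = ∅ := Set.eq_empty_of_isEmpty _
    rw [h1, h2, Measure.restrict_empty, integral_zero_measure, integral_zero_measure]
    simp
  obtain ⟨x₀⟩ := hN
  have ha₁0 : 0 ≤ a₁ := (innerDual_self_nonneg g hgR x₀ _).trans (hχ₁grad x₀)
  have ha₂0 : 0 ≤ a₂ := (innerDual_self_nonneg g hgR x₀ _).trans (hχ₂grad x₀)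
  have hb₁0 : 0 ≤ b₁ := (abs_nonneg _).trans (hb₁ x₀)
  have hb₂0 : 0 ≤ b₂ := (abs_nonneg _).trans (hb₂ x₀)
  have hm0 : (0 : ℝ) < m := by linarith
  have h3m : (0 : ℝ) < 3 * m - 2 := by linarith
  have hC0 : 0 ≤ C := by
    have h1 : 0 ≤ ((m : ℝ) - 1) / m := div_nonneg (by linarith) hm0.le
    have h2 : 0 ≤ 4 * ((m : ℝ) - 1) / (3 * m - 2) := div_nonneg (by linarith) h3m.le
    rw [hC]
    apply mul_nonneg
    · exact div_nonneg (by positivity) hD₄.le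
    · exact div_nonneg (by positivity) hD₂.le
  refine ⟨C, hC0, fun u hu harm hk hind ↦ ?_⟩
  -- the sets
  have hopen : ∀ r : ℝ≥0∞, IsOpen (g.ball p r) := fun r ↦ PseudoRiemannianMetric.isOpen_ball hgR p r
  have h24 : g.ball p (ENNReal.ofReal (s / 2)) ⊆ g.ball p (ENNReal.ofReal s) :=
    g.ball_mono p (ENNReal.ofReal_le_ofReal (by linarith))
  have hquarter : ENNReal.ofReal (s / 2 / 2) = ENNReal.ofReal (s / 4) := by
    congr 1
    ring
  have key := karpukhinStern_prop35_core h hu harm hK hK0 hm2 hm5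
    (S₁ := g.ball p (ENNReal.ofReal (s / 4))) (Ω₂ := g.ball p (ENNReal.ofReal (s / 2)))
    (Ω₃ := g.ball p (ENNReal.ofReal s)) (hopen _).measurableSet (hopen _).measurableSet h24
    hχ₁s hχ₁supp hχ₁one (fun x ↦ by rw [abs_of_nonneg (hχ₁0 x)]; exact hχ₁1 x) hχ₁grad hb₁
    hχ₂s hχ₂supp (fun x hx ↦ hχ₂one x (by rwa [hquarter])) (fun x ↦ by
      rw [abs_of_nonneg (hχ₂0 x)]; exact hχ₂1 x) hχ₂grad hb₂ hk hind
  rw [hC, mul_assoc]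
  exact key

/-- **Karpukhin–Stern, Lemma 3.7, from Lemma 3.6** (pp. 751–752). Assume `2 ≤ dim N ≤ 5`,
`Ric ≥ −K h`, and the conclusion of Lemma 3.6: a radius `δ > 0` such that every nonconstant
smooth harmonic `u : N → Sᵏ` (any `k`) has `ind_E(u; N ∖ B_δ(p)) ≥ k − 2` for every `p`
(hypothesis `h36`). Then there is `C = C(N, h)` such that every nonconstant smooth harmonic
`u : N → Sᵏ` with `k ≥ 205` and `ind_E(u) ≤ k + 1` satisfies the uniform bounds (3.8)–(3.9):
`∫ |du|⁶ ≤ C`, `∫ |du|⁴ ≤ C`, `∫ |d|du|²|² ≤ C`. Proof as printed: disjointness gives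
`ind_E(u; B_δ(p)) ≤ 3 ≤ k − 2 − 200` (`energyIndexOn_le_three`), Prop. 3.5 on the balls
`B(p, δ)` (`karpukhinStern_prop35_ball`), a finite cover of `N` by balls `B(pᵢ, δ/4)`
("a simple covering argument"), Hölder's inequality `∫|du|² ≤ Vol^{2/3}(∫|du|⁶)^{1/3}` and
division; (3.9) by `integral_gradSq_energyDensity_le`.
[cite: KarpukhinStern2024, Lemma 3.7 pp. 751–752] -/
theorem karpukhinStern_lemma37_of_lemma36 (hm2 : 2 ≤ m) (hm5 : m ≤ 5) {K : ℝ}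
    (hK : ∀ (x : N) (v : TangentSpace J x),
      -(K * (ofRiemannian h).val x v v) ≤ (ofRiemannian h).ricci x v v) (hK0 : 0 ≤ K)
    {δ : ℝ} (hδ : 0 < δ)
    (h36 : ∀ {k : ℕ} (u : N → Metric.sphere (0 : EuclideanSpace ℝ (Fin (k + 1))) 1)
      (hu : ContMDiff J (𝓡 k) ∞ u),
      (∀ (i : Fin (k + 1)) (x : N), (ofRiemannian h).dalembertian
        (fun y ↦ (u y : EuclideanSpace ℝ (Fin (k + 1))) i) x =
          -(energyDensity h u x) * (u x : EuclideanSpace ℝ (Fin (k + 1))) i) →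
      (∃ x y, u x ≠ u y) →
      ∀ p : N, ((k - 2 : ℕ) : ℕ∞) ≤ energyIndexOn h hu ((ofRiemannian h).ball p (ENNReal.ofReal δ))ᶜ) :
    ∃ C : ℝ, ∀ {k : ℕ} (u : N → Metric.sphere (0 : EuclideanSpace ℝ (Fin (k + 1))) 1)
      (hu : ContMDiff J (𝓡 k) ∞ u),
      (∀ (i : Fin (k + 1)) (x : N), (ofRiemannian h).dalembertian
        (fun y ↦ (u y : EuclideanSpace ℝ (Fin (k + 1))) i) x =
          -(energyDensity h u x) * (u x : EuclideanSpace ℝ (Fin (k + 1))) i) →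
      (∃ x y, u x ≠ u y) → 205 ≤ k → energyIndex h hu ≤ (k + 1 : ℕ) →
      ∫ x, energyDensity h u x ^ 3 ∂riemannianMeasure h ≤ C ∧
        ∫ x, energyDensity h u x ^ 2 ∂riemannianMeasure h ≤ C ∧
        ∫ x, (ofRiemannian h).gradSq (energyDensity h u) x ∂riemannianMeasure h ≤ C := by
  classical
  set g := ofRiemannian h with hg
  have hgR : g.IsRiemannian := isRiemannian_ofRiemannian h
  set μ := riemannianMeasure h with hμ
  haveI := isFiniteMeasure_riemannianMeasure h
  haveI := isOpenPosMeasure_riemannianMeasure h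
  -- a finite cover of `N` by balls `B(p, δ/4)`
  have hopen : ∀ (p : N) (r : ℝ≥0∞), IsOpen (g.ball p r) := fun p r ↦ PseudoRiemannianMetric.isOpen_ball hgR p r
  obtain ⟨t, ht⟩ := isCompact_univ.elim_finite_subcover (fun p : N ↦ g.ball p (ENNReal.ofReal (δ / 4)))
    (fun p ↦ hopen p _) (fun x _ ↦ Set.mem_iUnion.2 ⟨x, PseudoRiemannianMetric.mem_ball_self x
      (ENNReal.ofReal_pos.2 (by linarith))⟩)
  -- the constants of Prop. 3.5 on the balls `B(p, δ)`
  have hC : ∀ p : N, ∃ C : ℝ, 0 ≤ C ∧ ∀ {k : ℕ} (u : N → Metric.sphere (0 : EuclideanSpace ℝ (Fin (k + 1))) 1)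
      (hu : ContMDiff J (𝓡 k) ∞ u)
      (_harm : ∀ (i : Fin (k + 1)) (x : N), (ofRiemannian h).dalembertian
        (fun y ↦ (u y : EuclideanSpace ℝ (Fin (k + 1))) i) x =
          -(energyDensity h u x) * (u x : EuclideanSpace ℝ (Fin (k + 1))) i)
      (_hk : 202 ≤ k) (_hind : energyIndexOn h hu (g.ball p (ENNReal.ofReal δ)) ≤ (k - 202 : ℕ)),
      ∫ x in g.ball p (ENNReal.ofReal (δ / 4)), energyDensity h u x ^ 3 ∂μ ≤
        C * ∫ x in g.ball p (ENNReal.ofReal δ), energyDensity h u x ∂μ :=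
    fun p ↦ karpukhinStern_prop35_ball h hm2 hm5 hK hK0 p hδ
  choose Cf hCf0 hCf using hC
  set Ctot : ℝ := ∑ p ∈ t, Cf p with hCtot
  have hCtot0 : 0 ≤ Ctot := Finset.sum_nonneg fun p _ ↦ hCf0 p
  set V : ℝ := (μ Set.univ).toReal with hV
  set C₁ : ℝ := V * Ctot ^ ((3 : ℝ) / 2) with hC₁
  have hV0 : 0 ≤ V := ENNReal.toReal_nonneg
  have hC₁0 : 0 ≤ C₁ := mul_nonneg hV0 (Real.rpow_nonneg hCtot0 _)
  -- the final constant
  have hm' : (2 : ℝ) ≤ m := by exact_mod_cast hm2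
  set C₂ : ℝ := 2 * ((m : ℝ) - 1) / (3 * m - 2) * (2 * K * (V + 2 * C₁) + 2 * C₁) with hC₂
  refine ⟨max (V + 2 * C₁) C₂, fun {k} u hu harm hne hk hind ↦ ?_⟩
  set e := energyDensity h u with hedef
  have he : ContMDiff J 𝓘(ℝ, ℝ) ∞ e := contMDiff_energyDensity h hu
  have hec : Continuous e := he.continuous
  have he0 : ∀ x, 0 ≤ e x := fun x ↦ energyDensity_nonneg' h u x
  -- the index on each ball is `≤ 3 ≤ k − 202`
  have hk2 : 2 ≤ k := by omega
  have hk202 : 202 ≤ k := by omega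
  have hballInd : ∀ p : N, energyIndexOn h hu (g.ball p (ENNReal.ofReal δ)) ≤ (k - 202 : ℕ) := by
    intro p
    have h3 := energyIndexOn_le_three h hu hind (h36 u hu harm hne p) hk2
    refine h3.trans ?_
    have : (3 : ℕ) ≤ k - 202 := by omega
    exact_mod_cast this
  -- Step 1: `∫ e³ ≤ Ctot ∫ e`
  have hI3 : Integrable (fun x ↦ e x ^ 3) μ := integrable_of_continuous h (hec.pow 3)
  have hI1 : Integrable (fun x ↦ e x) μ := integrable_of_continuous h hec
  have hstep1 : ∫ x, e x ^ 3 ∂μ ≤ Ctot * ∫ x, e x ∂μ := by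
    -- `e³ ≤ ∑_{p ∈ t} 1_{B(p, δ/4)} e³` pointwise
    have hpt : ∀ x, e x ^ 3 ≤ ∑ p ∈ t, (g.ball p (ENNReal.ofReal (δ / 4))).indicator (fun y ↦ e y ^ 3) x := by
      intro x
      have hx : x ∈ ⋃ p ∈ t, g.ball p (ENNReal.ofReal (δ / 4)) := ht (Set.mem_univ x)
      obtain ⟨p, hp, hxp⟩ := Set.mem_iUnion₂.1 hx
      have hnn : ∀ q ∈ t, 0 ≤ (g.ball q (ENNReal.ofReal (δ / 4))).indicator (fun y ↦ e y ^ 3) x :=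
        fun q _ ↦ Set.indicator_nonneg (fun y _ ↦ pow_nonneg (he0 y) 3) x
      calc e x ^ 3 = (g.ball p (ENNReal.ofReal (δ / 4))).indicator (fun y ↦ e y ^ 3) x := by
            rw [Set.indicator_of_mem hxp]
        _ ≤ ∑ q ∈ t, (g.ball q (ENNReal.ofReal (δ / 4))).indicator (fun y ↦ e y ^ 3) x :=
            Finset.single_le_sum hnn hp
    have hIind : ∀ p ∈ t, Integrable ((g.ball p (ENNReal.ofReal (δ / 4))).indicator fun y ↦ e y ^ 3) μ :=
      fun p _ ↦ hI3.indicator (hopen p _).measurableSet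
    calc ∫ x, e x ^ 3 ∂μ ≤ ∫ x, ∑ p ∈ t, (g.ball p (ENNReal.ofReal (δ / 4))).indicator (fun y ↦ e y ^ 3) x ∂μ :=
          integral_mono hI3 (integrable_finsetSum' t hIind |>.congr (Eventually.of_forall fun x ↦ by
            simp [Finset.sum_apply])) hpt
      _ = ∑ p ∈ t, ∫ x, (g.ball p (ENNReal.ofReal (δ / 4))).indicator (fun y ↦ e y ^ 3) x ∂μ :=
          integral_finsetSum t hIind
      _ = ∑ p ∈ t, ∫ x in g.ball p (ENNReal.ofReal (δ / 4)), e x ^ 3 ∂μ :=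
          Finset.sum_congr rfl fun p _ ↦ integral_indicator (hopen p _).measurableSet
      _ ≤ ∑ p ∈ t, Cf p * ∫ x, e x ∂μ := by
          refine Finset.sum_le_sum fun p _ ↦ ?_
          refine (hCf p u hu harm hk202 (hballInd p)).trans ?_
          refine mul_le_mul_of_nonneg_left ?_ (hCf0 p)
          exact setIntegral_le_integral hI1 (Eventually.of_forall fun x ↦ he0 x)
      _ = Ctot * ∫ x, e x ∂μ := by rw [hCtot, Finset.sum_mul]
  -- Step 2: Hölder `V⁻¹ ∫ e ≤ (V⁻¹ ∫ e³)^{1/3}`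
  obtain ⟨x₀, -, -⟩ := hne
  have hVpos : 0 < V := by
    rw [hV]
    refine ENNReal.toReal_pos ?_ (measure_ne_top μ _)
    exact (isOpen_univ.measure_pos μ ⟨x₀, Set.mem_univ x₀⟩).ne'
  have hHolder := normalized_holder h (f := e) (g := fun _ ↦ (1 : ℝ)) hec continuous_const he0
    (fun _ ↦ zero_le_one) (Real.HolderConjugate.conjExponent (p := 3) (by norm_num))
  have hone : (((riemannianMeasure h) Set.univ).toReal⁻¹ *
      ∫ x, (1 : ℝ) ^ Real.conjExponent 3 ∂riemannianMeasure h) ^ (1 / Real.conjExponent 3) = 1 := by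
    have h1 : ∫ x, (1 : ℝ) ^ Real.conjExponent 3 ∂riemannianMeasure h = V := by
      rw [Real.one_rpow, integral_const, smul_eq_mul, mul_one]
      rfl
    rw [h1, inv_mul_cancel₀ hVpos.ne', Real.one_rpow]
  rw [hone, mul_one] at hHolder
  simp only [mul_one] at hHolder
  -- `hHolder : V⁻¹ * ∫ e ≤ (V⁻¹ * ∫ e ^ (3:ℝ)) ^ (1/3)`
  have hpow3 : ∀ t : ℝ, t ^ (3 : ℝ) = t ^ 3 := fun t ↦ Real.rpow_ofNat t 3
  simp_rw [hpow3] at hHolder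
  -- Step 3: `Y ≤ Ctot Y^{1/3}` for `Y = V⁻¹ ∫ e³`, hence `Y ≤ Ctot^{3/2}`
  set X : ℝ := ∫ x, e x ^ 3 ∂μ with hX
  set Y : ℝ := V⁻¹ * X with hY
  have hX0 : 0 ≤ X := integral_nonneg fun x ↦ pow_nonneg (he0 x) 3
  have hY0 : 0 ≤ Y := mul_nonneg (inv_nonneg.2 hV0) hX0
  have hYle : Y ≤ Ctot * Y ^ ((1 : ℝ) / 3) := by
    have h1 : V⁻¹ * X ≤ V⁻¹ * (Ctot * ∫ x, e x ∂μ) := mul_le_mul_of_nonneg_left hstep1 (inv_nonneg.2 hV0)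
    have h1' : V⁻¹ * (Ctot * ∫ x, e x ∂μ) = Ctot * (V⁻¹ * ∫ x, e x ∂μ) := by ring
    calc Y = V⁻¹ * X := rfl
      _ ≤ Ctot * (V⁻¹ * ∫ x, e x ∂μ) := h1.trans_eq h1'
      _ ≤ Ctot * Y ^ ((1 : ℝ) / 3) := mul_le_mul_of_nonneg_left hHolder hCtot0
  have hYbound : Y ≤ Ctot ^ ((3 : ℝ) / 2) := by
    rcases hY0.eq_or_lt with hY00 | hYpos
    · rw [← hY00]
      exact Real.rpow_nonneg hCtot0 _
    · have hY13 : 0 < Y ^ ((1 : ℝ) / 3) := Real.rpow_pos_of_pos hYpos _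
      have h23 : Y ^ ((2 : ℝ) / 3) ≤ Ctot := by
        have hsplit : Y = Y ^ ((2 : ℝ) / 3) * Y ^ ((1 : ℝ) / 3) := by
          rw [← Real.rpow_add hYpos]
          norm_num
        have h2 : Y ^ ((2 : ℝ) / 3) * Y ^ ((1 : ℝ) / 3) ≤ Ctot * Y ^ ((1 : ℝ) / 3) := hsplit ▸ hYle
        exact le_of_mul_le_mul_right h2 hY13
      have h0 : 0 ≤ Y ^ ((2 : ℝ) / 3) := Real.rpow_nonneg hY0 _
      calc Y = (Y ^ ((2 : ℝ) / 3)) ^ ((3 : ℝ) / 2) := by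
            rw [← Real.rpow_mul hY0]
            norm_num
        _ ≤ Ctot ^ ((3 : ℝ) / 2) := Real.rpow_le_rpow h0 h23 (by norm_num)
  have hXbound : X ≤ C₁ := by
    have : X = V * Y := by
      rw [hY, ← mul_assoc, mul_inv_cancel₀ hVpos.ne', one_mul]
    rw [this, hC₁]
    exact mul_le_mul_of_nonneg_left hYbound hV0
  -- Step 4: `∫ e² ≤ V + 2 C₁`, `∫ |de|² ≤ C₂`
  have hI2 : Integrable (fun x ↦ e x ^ 2) μ := integrable_of_continuous h (hec.pow 2)
  have hI13 : Integrable (fun x ↦ 1 + e x ^ 3) μ := (integrable_const 1).add hI3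
  have hI13' : Integrable (fun x ↦ e x + e x ^ 3) μ := hI1.add hI3
  have hE1 : ∫ x, e x ∂μ ≤ V + X := by
    have hpt : ∀ x, e x ≤ 1 + e x ^ 3 := by
      intro x
      rcases le_or_gt (e x) 1 with h1 | h1
      · linarith [pow_nonneg (he0 x) 3]
      · have h2 : 0 ≤ e x * (e x - 1) * (e x + 1) :=
          mul_nonneg (mul_nonneg (he0 x) (by linarith)) (by linarith)
        nlinarith [h2]
    calc ∫ x, e x ∂μ ≤ ∫ x, (1 + e x ^ 3) ∂μ := integral_mono hI1 hI13 hpt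
      _ = V + X := by
          rw [integral_add (integrable_const 1) hI3, integral_const, smul_eq_mul, mul_one, hV, hX]
          rfl
  have hE2 : ∫ x, e x ^ 2 ∂μ ≤ V + 2 * C₁ := by
    have hpt : ∀ x, e x ^ 2 ≤ e x + e x ^ 3 := by
      intro x
      rcases le_or_gt (e x) 1 with h1 | h1
      · have h2 : 0 ≤ e x * (1 - e x) := mul_nonneg (he0 x) (by linarith)
        nlinarith [h2, pow_nonneg (he0 x) 3]
      · have h2 : 0 ≤ e x ^ 2 * (e x - 1) := mul_nonneg (sq_nonneg _) (by linarith)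
        nlinarith [h2, he0 x]
    calc ∫ x, e x ^ 2 ∂μ ≤ ∫ x, (e x + e x ^ 3) ∂μ := integral_mono hI2 hI13' hpt
      _ = (∫ x, e x ∂μ) + X := by rw [integral_add hI1 hI3]
      _ ≤ V + 2 * C₁ := by linarith
  have hE3 : ∫ x, g.gradSq e x ∂μ ≤ C₂ := by
    have h39 := integral_gradSq_energyDensity_le h hu harm hK
    have h3m : (0 : ℝ) < 3 * m - 2 := by linarith
    have hm1 : (0 : ℝ) ≤ (m : ℝ) - 1 := by linarith
    have hcm : 0 ≤ 2 - 2 / (m : ℝ) := by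
      have : 2 / (m : ℝ) ≤ 1 := by rw [div_le_one (by linarith)]; linarith
      linarith
    rw [hC₂, div_mul_eq_mul_div, le_div_iff₀ h3m]
    have hb : 2 * ((m : ℝ) - 1) * (2 * K * ∫ x, e x ^ 2 ∂μ + (2 - 2 / m) * ∫ x, e x ^ 3 ∂μ) ≤
        2 * ((m : ℝ) - 1) * (2 * K * (V + 2 * C₁) + 2 * C₁) := by
      refine mul_le_mul_of_nonneg_left ?_ (by linarith)
      have h1 : 2 * K * ∫ x, e x ^ 2 ∂μ ≤ 2 * K * (V + 2 * C₁) :=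
        mul_le_mul_of_nonneg_left hE2 (by linarith)
      have h2 : (2 - 2 / (m : ℝ)) * ∫ x, e x ^ 3 ∂μ ≤ 2 * C₁ := by
        calc (2 - 2 / (m : ℝ)) * ∫ x, e x ^ 3 ∂μ ≤ 2 * ∫ x, e x ^ 3 ∂μ := by
              apply mul_le_mul_of_nonneg_right _ hX0
              have : 0 ≤ 2 / (m : ℝ) := by positivity
              linarith
          _ ≤ 2 * C₁ := by linarith
      linarith
    linarith
  exact ⟨hXbound.trans ((by linarith : C₁ ≤ V + 2 * C₁).trans (le_max_left _ _)),
    hE2.trans (le_max_left _ _), hE3.trans (le_max_right _ _)⟩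

end Balls

end KarpukhinStern

end Literature.Geometry.Riemannian
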